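import Literature.Barriers.RiemannHypothesis.DeBrangesPositivityDirichletProofs
import Literature.Barriers.RiemannHypothesis.DeBrangesPositivityXiZeta
import Literature.NumberTheory.LFunctions.HurwitzCertifiedEvaluation
import Literature.NumberTheory.LFunctions.DirichletXiConjugation
import Literature.Analysis.SpecialFunctions.DigammaStirlingSecondOrder
import HarnessLib

/-!
# Conrey–Li's failure of de Branges' `𝓗(E_{χ₄})`-positivity: certified proof of `ConreyLi2000_HE_chi4`

LABEL (line 1): RH-FREE NEGATIVE result, now PROVED (kernel-certified numerics): de Branges'
positivity condition (3.7) FAILS for `L(s, χ₄)`. bears_on: B-C/B-P (LADDER-RH §1, COLUMN 6 DBR).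
WHAT THIS IS NOT: not progress toward RH or GRH in either direction — it certifies a printed
refutation of a sufficient condition; nothing here bears on the truth of RH.

Barrier catalogue `Literature/Barriers/RiemannHypothesis/`, sibling of
`DeBrangesPositivityDirichlet.lean` (the typed facts) and `DeBrangesPositivityDirichletProofs.lean`
(Sarnak's all-`χ` refutation `ConreyLi2000_FW_char_holds`). We DISCHARGE the named fact
`Literature.Barriers.RiemannHypothesis.ConreyLi2000_HE_chi4` (Conrey–Li 2000, §3.2: at the zero
`ρ = ½ + i·67.6369208635…` of `L(s, χ₄)`, `Re{conj ξ′(ρ, χ₄) · ξ(1+ρ, χ₄)} < 0`; printed value for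
Conrey–Li's `ξ_CL = (√π/2)·dirichletXi`: `−Re{ξ_CL′(ρ)ξ_CL(1+ρ)} = −2.3103…·10⁻⁴⁵`, a MATHEMATICA
evaluation) and hence the catalogued barrier `DeBrangesPositivityDirichlet`
(`DeBrangesPositivityDirichlet_holds`), exactly as the `ζ` entry `ConreyLi2000_HE` was discharged in
`DeBrangesPositivityHE.lean`: by a KERNEL-CHECKED interval computation (`decide +kernel`, no
compiler axiom) on top of the certified evaluator of `L(s, χ₄)`
(`Literature.NumberTheory.LFunctions.HurwitzNumerics.lchi4Eval`, Hurwitz Euler–Maclaurin).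

## Method

**1. No `Γ`-numerics** (`re_conj_deriv_dirichletXi_mul_eq`). `ξ(s, χ₄) = A(s)·L(s, χ₄)` with
`A(s) = 4^{(s+1)/2} Γ_ℝ(s+1)` (`xiFactorChi4`; `χ₄` is odd) on `Re s > −1`. At a zero `ρ = ½ + iγ`
of `L`, `ξ′(ρ) = A(ρ)L′(ρ)` and, since `conj ρ = 1 − ρ`,
`conj A(ρ) · A(1+ρ) = 16 · Γ_ℝ(2−ρ) Γ_ℝ(2+ρ) = 16 · (ρ/2π) · Γ_ℝ(ρ)Γ_ℝ(2−ρ) = 8ρ/(π sin(πρ/2))`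
(`Complex.Gammaℝ_add_two`, the reflection `Γ_ℝ(s)Γ_ℝ(2−s) = 1/sin(πs/2)` of
`DeBrangesPositivityXiZeta.lean`), and `sin(πρ/2) = (√2/2)cosh y · (1 + i tanh y)`, `y = πγ/2`.
Hence, with an explicit `c > 0`,
`Re{conj ξ′(ρ) ξ(1+ρ)} = c · Re{ conj L′(ρ) · L(3/2+iγ) · ρ · (1 − i tanh y) }`, and
`tanh y ∈ [1 − 2⁻¹², 1]` for `γ ≥ 64`.

**2. A zero ON the line from two values of `L`** (`exists_zero_of_lvalues`). `ξ(½+it, χ₄)` is REAL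
(`ε(χ₄) = 1`; tree `dirichletXi_criticalLine_eq_rootNumber_mul_conj`,
`PrimitiveQuadratic.rootNumber_eq_one_of_isQuadratic`), and
`ξ(½+it₁)·conj ξ(½+it₂) = |A₁|² e^{Re E} · e^{−i Im E} · L(½+it₁) conj L(½+it₂)` where
`A(½+it₂) = A(½+it₁) e^{E}`, `‖E‖ ≤ 5(t₂ − t₁)` (`Γ(w₂) = Γ(w₁) exp ∫ψ`, tree
`Gamma_eq_mul_exp_integral_digamma`, with the crude bound `‖ψ(w)‖ ≤ 7` for `Re w > 0`, `Im w ≥ 1`,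
`‖w‖ ≤ 35` from `norm_digamma_sub_log_add_inv_le`). So if `Re(L₁ conj L₂ e^{iy}) < 0` for all
`|y| ≤ 5(t₂−t₁)`, then `ξ` changes sign on `[t₁, t₂]` and `L(½+iγ, χ₄) = 0` for some `γ` there.

**3. `L′(ρ)` from two values** (`norm_deriv_sub_slope_le_of_bound`): for an entire `f` bounded by `M`
on the box `|Re v − ½| ≤ ¼`, `Im v ∈ [t₁ − ¼, t₂ + ¼]`, Cauchy's estimate twice (radii `1/8`) gives
`‖f″‖ ≤ 64M` on the segment and `‖f′(½+iγ) − (f₂ − f₁)/((t₂−t₁)i)‖ ≤ (t₂−t₁)·64M`; the bound `M`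
for `f = L(·, χ₄)` is itself read off one box evaluation of `lchi4Eval` (inclusion monotonicity).

**4. The certificate** (`ConreyLi2000Chi4Cert`, scale `2^80`, `N = 64`, `ν = 14`): with
`t₁ = T1/2⁴⁸ = γ − 2⁻³³ + O(2⁻⁴⁸)`, `t₂ = t₁ + 2⁻³²`: `hi Re V < 0` and `2²⁹ hi Re V + 2 absHi Im V < 0`
for `V ∋ L₁ conj L₂` (`Re V ≈ −6.9·10⁻²⁰`), the slope box `D ∋ L′(ρ)` (`≈ 0.9403 − 2.0565i`,
radius `absHi(L on the box)/2²⁶`), `Z₃ ∋ L(3/2+iγ)`, and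
`hi Re(conj D · Z₃ · ρ · (1 − iτ)) < 0` (`≈ −11.3 + 172.4 i`: margin `6 %` of the modulus).
`check_holds : check = true` by `decide +kernel`; `sound` is its soundness;
`ConreyLi2000_HE_chi4_holds` assembles.

## References

* [ConreyLi2000] J. B. Conrey, X.-J. Li, *A note on some positivity conditions related to zeta and
  L-functions*, IMRN 2000:18, 929–940 = arXiv:math/9812166, §3.2 (`ρ = 1/2 + i67.6369208635460683980549`,
  `−Re{ξ′(ρ,χ₄)ξ(1+ρ,χ₄)} = −2.310349004993483456·10⁻⁴⁵`).
* [MontgomeryVaughan2007] H. L. Montgomery, R. C. Vaughan, *Multiplicative Number Theory I*,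
  §10.1 (10.17)–(10.19), Exercise 10.1.13 (`ξ(½+it,χ)e^{−iθ}` real).
* [Edwards1974] H. M. Edwards, *Riemann's Zeta Function*, §6.4 (Euler–Maclaurin).
* [Brent1979] R. P. Brent, Math. Comp. 33 (1979), §3 (zeros on the line from sign changes).
-/

open Complex Set Filter Metric
open Literature.NumberTheory.LFunctions Literature.NumberTheory.LFunctions.DirichletTheta
open Literature.NumberTheory.LFunctions.HurwitzNumerics
open Literature.Analysis.ValidatedNumerics.NumericsMP
open Literature.Analysis.SpecialFunctions.Complex (norm_digamma_sub_log_add_inv_le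
  Gamma_eq_mul_exp_integral_digamma)
open scoped Real ComplexConjugate Topology

namespace Literature.Barriers.RiemannHypothesis

/-! ## 1. Reduction to `L`-data (no `Γ`-numerics) -/

/-- The Archimedean factor of `ξ(s, χ₄)`: `A(s) = 4^{(s+1)/2} · Γ_ℝ(s+1)`
(`Γ_ℝ(s) = π^{-s/2}Γ(s/2)`), so that `ξ(s, χ₄) = A(s)·L(s, χ₄)` (`χ₄` odd, `q = 4`).
[cite: MontgomeryVaughan2007, (10.19)] -/
noncomputable def xiFactorChi4 (s : ℂ) : ℂ := (4 : ℂ) ^ ((s + 1) / 2) * Gammaℝ (s + 1)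

section Reduction

variable {χ : DirichletCharacter ℂ 4}

/-- A primitive character mod `4` is not the trivial character (its conductor is `4 ≠ 1`).
[cite: MontgomeryVaughan2007, Theorem 9.13] -/
theorem ne_one_of_isPrimitive_four (hχ : χ.IsPrimitive) : χ ≠ 1 := by
  intro h
  have hc : χ.conductor = 4 := hχ
  rw [h, DirichletCharacter.conductor_one] at hc
  norm_num at hc

/-- A primitive character mod `4` is odd: `χ(−1) = χ(3) = −1`. [cite: MontgomeryVaughan2007, Theorem 9.13] -/
theorem odd_of_isPrimitive_four (hχ : χ.IsPrimitive) : χ.Odd := by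
  have h3 := PrimitiveQuadratic.apply_three_of_isPrimitive_four hχ (isQuadratic_of_modulus_four χ)
  show χ (-1) = -1
  rw [show (-1 : ZMod 4) = 3 by decide]
  exact h3

/-- The parity exponent of the primitive character mod `4` is `1`. [cite: MontgomeryVaughan2007, (10.15)] -/
theorem charParity_eq_one_of_isPrimitive_four (hχ : χ.IsPrimitive) : charParity χ = 1 :=
  charParity_of_odd (odd_of_isPrimitive_four hχ)

/-- `ξ(s, χ₄) = A(s) · L(s, χ₄)` on `Re s > −1` (`Λ(s,χ) = Γ_ℝ(s+1) L(s,χ)`, `Γ_ℝ(s+1) ≠ 0` there).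
[cite: MontgomeryVaughan2007, (10.19)] -/
theorem dirichletXi_eq_xiFactorChi4_mul (hχ : χ.IsPrimitive) {s : ℂ} (hs : -1 < s.re) :
    dirichletXi χ s = xiFactorChi4 s * χ.LFunction s := by
  have hκ := charParity_eq_one_of_isPrimitive_four hχ
  have hre : 0 < (s + 1).re := by simp; linarith
  have hG : Gammaℝ (s + 1) ≠ 0 := Gammaℝ_ne_zero_of_re_pos hre
  have hL : χ.completedLFunction s = Gammaℝ (s + 1) * χ.LFunction s := by
    rw [DirichletCharacter.LFunction_eq_completed_div_gammaFactor χ s (Or.inr (by norm_num)),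
      gammaFactor_eq_Gammaℝ, hκ, Nat.cast_one, mul_div_cancel₀ _ hG]
  rw [dirichletXi_def, hL, hκ, Nat.cast_one, xiFactorChi4]
  push_cast
  ring

/-- `A` is holomorphic on `Re s > −1`. [folklore] -/
private theorem differentiableAt_xiFactorChi4 {s : ℂ} (hs : -1 < s.re) : DifferentiableAt ℂ xiFactorChi4 s := by
  have hre : 0 < (s + 1).re := by simp; linarith
  have hG : Gammaℝ (s + 1) ≠ 0 := Gammaℝ_ne_zero_of_re_pos hre
  have h0 : Differentiable ℂ (fun z : ℂ ↦ (Gammaℝ (z + 1))⁻¹) :=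
    differentiable_Gammaℝ_inv.comp (differentiable_id.add_const 1)
  have h1 : DifferentiableAt ℂ (fun z : ℂ ↦ ((Gammaℝ (z + 1))⁻¹)⁻¹) s :=
    (h0 s).inv (inv_ne_zero hG)
  have h2 : (fun z : ℂ ↦ ((Gammaℝ (z + 1))⁻¹)⁻¹) = fun z ↦ Gammaℝ (z + 1) :=
    funext fun z ↦ inv_inv _
  rw [h2] at h1
  have h3 : DifferentiableAt ℂ (fun z : ℂ ↦ (4 : ℂ) ^ ((z + 1) / 2)) s :=
    DifferentiableAt.const_cpow (by fun_prop) (Or.inl (by norm_num))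
  exact h3.mul h1

/-- `A(s) ≠ 0` on `Re s > −1`. [folklore] -/
private theorem xiFactorChi4_ne_zero {s : ℂ} (hs : -1 < s.re) : xiFactorChi4 s ≠ 0 := by
  have hre : 0 < (s + 1).re := by simp; linarith
  refine mul_ne_zero ?_ (Gammaℝ_ne_zero_of_re_pos hre)
  rw [Ne, cpow_eq_zero_iff, not_and_or]
  exact Or.inl (by norm_num)

/-- At a zero `ρ` of `L(·, χ₄)` with `Re ρ > −1`: `ξ′(ρ, χ₄) = A(ρ) L′(ρ, χ₄)`. [folklore] -/
private theorem deriv_dirichletXi_eq_of_zero (hχ : χ.IsPrimitive) {ρ : ℂ} (hρ : -1 < ρ.re)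
    (hz : χ.LFunction ρ = 0) :
    deriv (dirichletXi χ) ρ = xiFactorChi4 ρ * deriv χ.LFunction ρ := by
  have h1 := ne_one_of_isPrimitive_four hχ
  have hopen : IsOpen {s : ℂ | -1 < s.re} := isOpen_lt continuous_const Complex.continuous_re
  have hev : dirichletXi χ =ᶠ[𝓝 ρ] fun s ↦ xiFactorChi4 s * χ.LFunction s := by
    filter_upwards [hopen.mem_nhds hρ] with s hs
    exact dirichletXi_eq_xiFactorChi4_mul hχ hs
  rw [hev.deriv_eq, deriv_fun_mul (differentiableAt_xiFactorChi4 hρ)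
    ((DirichletCharacter.differentiable_LFunction h1) ρ), hz, mul_zero, zero_add]

/-- `conj (½ + iγ) = 1 − (½ + iγ)`. [folklore] -/
private lemma conj_half_add' (γ : ℝ) : conj (1 / 2 + γ * I : ℂ) = 1 - (1 / 2 + γ * I) := by
  apply Complex.ext
  · simp; norm_num
  · simp

/-- `conj A(s) = A(conj s)` (`4` is a positive real; `Γ_ℝ` commutes with conjugation). [folklore] -/
private theorem conj_xiFactorChi4 (s : ℂ) : conj (xiFactorChi4 s) = xiFactorChi4 (conj s) := by
  unfold xiFactorChi4
  have h4 : (4 : ℂ).arg ≠ π := by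
    rw [show (4 : ℂ) = ((4 : ℝ) : ℂ) by norm_num, Complex.arg_ofReal_of_nonneg (by norm_num)]
    exact Real.pi_ne_zero.symm
  rw [map_mul, ← Gammaℝ_conj, map_add, map_one]
  congr 1
  have e : ((starRingEnd ℂ) s + 1) / 2 = conj ((s + 1) / 2) := by
    simp only [map_div₀, map_add, map_one, map_ofNat]
  rw [e, Complex.cpow_conj _ _ h4, map_ofNat]

/-- **The `Γ`-factors at a critical-line point**: for `ρ = ½ + iγ` there is `c > 0` with
`conj A(ρ) · A(1+ρ) = c · ρ · (1 − i tanh(πγ/2))`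
(`= 8ρ/(π sin(πρ/2))`: `Γ_ℝ(ρ+2) = Γ_ℝ(ρ)ρ/(2π)`, `Γ_ℝ(ρ)Γ_ℝ(2−ρ) = 1/sin(πρ/2)`,
`sin(πρ/2) = (√2/2)cosh(πγ/2)(1 + i tanh(πγ/2))`). [folklore] -/
private theorem conj_xiFactorChi4_mul_xiFactorChi4 (γ : ℝ) :
    ∃ c : ℝ, 0 < c ∧ conj (xiFactorChi4 (1 / 2 + γ * I)) * xiFactorChi4 (1 + (1 / 2 + γ * I)) =
      (c : ℂ) * ((1 / 2 + γ * I) * (1 - (Real.tanh (π * γ / 2) : ℂ) * I)) := by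
  set ρ : ℂ := 1 / 2 + γ * I with hρ
  have hconj : conj ρ = 1 - ρ := conj_half_add' γ
  have hρ0 : ρ ≠ 0 := fun h ↦ by
    have := congrArg Complex.re h; simp [hρ] at this
  set τ : ℝ := Real.tanh (π * γ / 2) with hτ
  set k : ℝ := Real.sqrt 2 / 2 * Real.cosh (π * γ / 2) with hk
  have hkpos : 0 < k := sqrt_two_div_two_mul_cosh_pos γ
  have hsin : Complex.sin (π * ρ / 2) = (k : ℂ) * (1 + τ * I) := sin_pi_mul_half_critical γ
  have h1τ : (1 : ℂ) + τ * I ≠ 0 := by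
    intro h; have := congrArg Complex.re h; simp at this
  have h1τ' : (1 : ℂ) - τ * I ≠ 0 := by
    intro h; have := congrArg Complex.re h; simp at this
  have hτ2 : (1 : ℂ) + τ ^ 2 = (1 + τ * I) * (1 - τ * I) := by
    ring_nf; rw [Complex.I_sq]; ring
  have h1τ2 : (1 : ℂ) + τ ^ 2 ≠ 0 := by rw [hτ2]; exact mul_ne_zero h1τ h1τ'
  have hk' : (k : ℂ) ≠ 0 := ofReal_ne_zero.mpr hkpos.ne'
  have hπ : (π : ℂ) ≠ 0 := ofReal_ne_zero.mpr Real.pi_ne_zero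
  -- the two Gamma identities
  have hΓ2 : Gammaℝ (1 + ρ + 1) = Gammaℝ ρ * ρ / 2 / π := by
    rw [show (1 : ℂ) + ρ + 1 = ρ + 2 by ring]; exact Gammaℝ_add_two hρ0
  have hrefl : Gammaℝ ρ * Gammaℝ (1 - ρ + 1) = 1 / Complex.sin (π * ρ / 2) := by
    rw [show (1 : ℂ) - ρ + 1 = 2 - ρ by ring]; exact Gammaℝ_mul_Gammaℝ_two_sub ρ
  -- the powers of `4`
  have h4 : (4 : ℂ) ^ ((1 - ρ + 1) / 2) * (4 : ℂ) ^ ((1 + ρ + 1) / 2) = 16 := by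
    rw [← cpow_add _ _ (by norm_num : (4 : ℂ) ≠ 0),
      show (1 - ρ + 1) / 2 + (1 + ρ + 1) / 2 = ((2 : ℕ) : ℂ) by push_cast; ring, cpow_natCast]
    norm_num
  refine ⟨8 / (π * k * (1 + τ ^ 2)), by positivity, ?_⟩
  rw [conj_xiFactorChi4, hconj]
  unfold xiFactorChi4
  calc (4 : ℂ) ^ ((1 - ρ + 1) / 2) * Gammaℝ (1 - ρ + 1) *
        ((4 : ℂ) ^ ((1 + ρ + 1) / 2) * Gammaℝ (1 + ρ + 1))
      = ((4 : ℂ) ^ ((1 - ρ + 1) / 2) * (4 : ℂ) ^ ((1 + ρ + 1) / 2)) *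
          (Gammaℝ (1 - ρ + 1) * Gammaℝ (1 + ρ + 1)) := by ring
    _ = 16 * (ρ / 2 / π * (Gammaℝ ρ * Gammaℝ (1 - ρ + 1))) := by rw [h4, hΓ2]; ring
    _ = 16 * (ρ / 2 / π * (1 / ((k : ℂ) * (1 + τ * I)))) := by rw [hrefl, hsin]
    _ = _ := by
      have e8 : (((8 / (π * k * (1 + τ ^ 2)) : ℝ)) : ℂ) = 8 / ((π : ℂ) * k * (1 + τ ^ 2)) := by
        push_cast; ring
      rw [e8]
      field_simp
      rw [hτ2]
      ring

/-- **Reduction of Conrey–Li's quantity for `χ₄` to `L`-data.** At a zero `ρ = ½ + iγ` (`γ > 0`)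
of `L(·, χ₄)` (any real `γ`):
`Re{conj ξ′(ρ, χ₄)·ξ(1+ρ, χ₄)} = c · Re{conj L′(ρ, χ₄)·L(3/2+iγ, χ₄)·(ρ·(1 − i tanh(πγ/2)))}`
for some `c > 0`. [cite: ConreyLi2000, §3.2] -/
theorem re_conj_deriv_dirichletXi_mul_eq (hχ : χ.IsPrimitive) {γ : ℝ}
    (hz : χ.LFunction (1 / 2 + γ * I) = 0) :
    ∃ c : ℝ, 0 < c ∧
      (conj (deriv (dirichletXi χ) (1 / 2 + γ * I)) * dirichletXi χ (1 + (1 / 2 + γ * I))).re =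
        c * (conj (deriv χ.LFunction (1 / 2 + γ * I)) * χ.LFunction (3 / 2 + γ * I) *
              ((1 / 2 + γ * I) * (1 - (Real.tanh (π * γ / 2) : ℂ) * I))).re := by
  set ρ : ℂ := 1 / 2 + γ * I with hρ
  have hρre : -1 < ρ.re := by simp [hρ]; norm_num
  have h1ρre : -1 < (1 + ρ).re := by simp [hρ]; norm_num
  have hd : deriv (dirichletXi χ) ρ = xiFactorChi4 ρ * deriv χ.LFunction ρ :=
    deriv_dirichletXi_eq_of_zero hχ hρre hz
  have hx1 : dirichletXi χ (1 + ρ) = xiFactorChi4 (1 + ρ) * χ.LFunction (1 + ρ) :=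
    dirichletXi_eq_xiFactorChi4_mul hχ h1ρre
  have h32 : (1 : ℂ) + ρ = 3 / 2 + γ * I := by rw [hρ]; ring
  obtain ⟨c, hc, hfac⟩ := conj_xiFactorChi4_mul_xiFactorChi4 γ
  refine ⟨c, hc, ?_⟩
  have hmain : conj (deriv (dirichletXi χ) ρ) * dirichletXi χ (1 + ρ) =
      (c : ℂ) * (conj (deriv χ.LFunction ρ) * χ.LFunction (3 / 2 + γ * I) *
        ((1 / 2 + γ * I) * (1 - (Real.tanh (π * γ / 2) : ℂ) * I))) := by
    rw [hd, hx1, map_mul]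
    calc conj (xiFactorChi4 ρ) * conj (deriv χ.LFunction ρ) *
          (xiFactorChi4 (1 + ρ) * χ.LFunction (1 + ρ))
        = (conj (xiFactorChi4 ρ) * xiFactorChi4 (1 + ρ)) *
            (conj (deriv χ.LFunction ρ) * χ.LFunction (1 + ρ)) := by ring
      _ = _ := by rw [hfac, h32]; ring
  rw [hmain, Complex.re_ofReal_mul]

/-- `tanh(πγ/2) ∈ [1 − 2⁻¹², 1]` for `γ ≥ 64` (`1 − tanh x ≤ 2/(1+x)²`, `x = πγ/2 ≥ 100`). [folklore] -/
private theorem tanh_mem_Icc_of_ge {γ : ℝ} (hγ : 64 ≤ γ) :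
    Real.tanh (π * γ / 2) ∈ Set.Icc (1 - (1 / 4096 : ℝ)) 1 := by
  refine ⟨?_, tanh_le_one _⟩
  have hπ := Real.pi_gt_d2
  have hx : 100 ≤ π * γ / 2 := by nlinarith
  have h := one_sub_tanh_le (x := π * γ / 2) (by linarith)
  have h101 : (10201 : ℝ) ≤ (1 + π * γ / 2) ^ 2 := by nlinarith
  have : 2 / (1 + π * γ / 2) ^ 2 ≤ 2 / 10201 :=
    div_le_div_of_nonneg_left (by norm_num) (by norm_num) h101
  linarith

end Reduction

/-! ## 2. A zero on the critical line from two values of `L(·, χ₄)` -/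

section SignTest

variable {χ : DirichletCharacter ℂ 4}

/-- `ξ(½ + it, χ₄)` is real (`ε(χ₄) = 1`, Montgomery–Vaughan Exercise 10.1.13 with `θ = 0`).
[cite: MontgomeryVaughan2007, §10.1.1 Exercise 13] -/
theorem dirichletXi_criticalLine_im_eq_zero (hχ : χ.IsPrimitive) (t : ℝ) :
    (dirichletXi χ (1 / 2 + t * I)).im = 0 := by
  have h1 := ne_one_of_isPrimitive_four hχ
  have hε : χ.rootNumber = 1 :=
    PrimitiveQuadratic.rootNumber_eq_one_of_isQuadratic hχ (isQuadratic_of_modulus_four χ)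
  have h := dirichletXi_criticalLine_eq_rootNumber_mul_conj hχ h1 t
  rw [hε, one_mul] at h
  have := congrArg Complex.im h
  rw [Complex.conj_im] at this
  linarith

/-- A crude bound for the digamma function in the first quadrant away from the real axis:
`‖ψ(w)‖ ≤ 7` for `Re w > 0`, `Im w ≥ 1`, `‖w‖ ≤ 35` (second-order Stirling
`norm_digamma_sub_log_add_inv_le`, `‖Log w‖ ≤ log ‖w‖ + π/2`, `log 35 < 3.6`). [folklore] -/
private theorem norm_digamma_le_seven {w : ℂ} (hre : 0 < w.re) (him : 1 ≤ w.im) (hn : ‖w‖ ≤ 35) :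
    ‖Complex.digamma w‖ ≤ 7 := by
  have hπ3 := Real.pi_gt_three
  have hπ4 := Real.pi_lt_d2
  have hst := norm_digamma_sub_log_add_inv_le hre (by linarith)
  have hw1 : 1 ≤ ‖w‖ := le_trans him (le_trans (le_abs_self _) (Complex.abs_im_le_norm w))
  have hw0 : w ≠ 0 := fun h ↦ by rw [h] at hw1; norm_num at hw1
  -- Stirling remainder ≤ 0.9
  have hrem : 2 * (1 / (6 * |w.im| ^ 3) + π / (12 * w.im ^ 2)) ≤ 9 / 10 := by
    rw [abs_of_pos (by linarith)]
    have h3 : 1 ≤ w.im ^ 3 := by nlinarith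
    have h2 : 1 ≤ w.im ^ 2 := by nlinarith
    have ha : 1 / (6 * w.im ^ 3) ≤ 1 / 6 := by
      apply div_le_div_of_nonneg_left (by norm_num) (by norm_num) (by nlinarith)
    have hb : π / (12 * w.im ^ 2) ≤ π / 12 := by
      apply div_le_div_of_nonneg_left (by linarith) (by norm_num) (by nlinarith)
    nlinarith
  -- `‖Log w‖ ≤ 3.6 + π/2`
  have hlog : ‖Complex.log w‖ ≤ 36 / 10 + π / 2 := by
    have h1 : ‖Complex.log w‖ ≤ |(Complex.log w).re| + |(Complex.log w).im| :=
      Complex.norm_le_abs_re_add_abs_im _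
    rw [Complex.log_re, Complex.log_im] at h1
    have hln : |Real.log ‖w‖| ≤ 36 / 10 := by
      rw [abs_of_nonneg (Real.log_nonneg hw1)]
      have e : Real.log ‖w‖ = Real.log (‖w‖ / 32) + 5 * Real.log 2 := by
        rw [Real.log_div (by linarith) (by norm_num), show (32 : ℝ) = 2 ^ 5 by norm_num,
          Real.log_pow]
        push_cast; ring
      have hA : Real.log (‖w‖ / 32) ≤ ‖w‖ / 32 - 1 := Real.log_le_sub_one_of_pos (by positivity)
      have hl2 := Real.log_two_lt_d9
      rw [e]
      nlinarith
    have harg : |Complex.arg w| ≤ π / 2 := by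
      have := (Complex.abs_arg_lt_pi_div_two_iff (z := w)).2 (Or.inl hre)
      exact this.le
    linarith
  -- `‖1/(2w)‖ ≤ 1/2`
  have hinv : ‖1 / (2 * w)‖ ≤ 1 / 2 := by
    rw [norm_div, norm_one, norm_mul, Complex.norm_ofNat]
    rw [div_le_div_iff₀ (by positivity) (by norm_num)]
    nlinarith
  have htri : ‖Complex.digamma w‖ ≤
      ‖Complex.digamma w - Complex.log w + 1 / (2 * w)‖ +
        ‖Complex.log w‖ + ‖1 / (2 * w)‖ := by
    have := norm_add_le (Complex.digamma w - Complex.log w +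
      1 / (2 * w)) (Complex.log w - 1 / (2 * w))
    have e : Complex.digamma w - Complex.log w + 1 / (2 * w) +
        (Complex.log w - 1 / (2 * w)) = Complex.digamma w := by
      ring
    rw [e] at this
    have := norm_sub_le (Complex.log w) (1 / (2 * w))
    linarith
  linarith

/-- **The Archimedean factor along the critical line**: for `2 ≤ t₁ ≤ t₂ ≤ 68`,
`A(½+it₂) = A(½+it₁)·e^{E}` with `‖E‖ ≤ 5 (t₂ − t₁)`
(`E = (w₂−w₁)(log 4 − log π) + ∫_{[w₁,w₂]} ψ`, `w_j = ¾ + it_j/2`, `Γ(w₂) = Γ(w₁)e^{∫ψ}`, `‖ψ‖ ≤ 7`).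
[folklore] -/
private theorem xiFactorChi4_eq_mul_exp {t₁ t₂ : ℝ} (h2 : 2 ≤ t₁) (h12 : t₁ ≤ t₂) (h68 : t₂ ≤ 68) :
    ∃ E : ℂ, ‖E‖ ≤ 5 * (t₂ - t₁) ∧
      xiFactorChi4 (1 / 2 + t₂ * I) = xiFactorChi4 (1 / 2 + t₁ * I) * Complex.exp E := by
  set w₁ : ℂ := 3 / 4 + ((t₁ / 2 : ℝ) : ℂ) * I with hw₁def
  set d : ℂ := (((t₂ - t₁) / 2 : ℝ) : ℂ) * I with hd
  set w₂ : ℂ := w₁ + d with hw₂def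
  have hw₁ : (1 / 2 + (t₁ : ℂ) * I + 1) / 2 = w₁ := by
    simp only [hw₁def]; push_cast; ring
  have hw₂ : (1 / 2 + (t₂ : ℂ) * I + 1) / 2 = w₂ := by
    simp only [hw₂def, hw₁def, hd]; push_cast; ring
  have him₁ : 0 < w₁.im := by simp [hw₁def]; linarith
  have him₂ : 0 < w₂.im := by simp [hw₂def, hw₁def, hd]; linarith
  have hΓ := Gamma_eq_mul_exp_integral_digamma him₁ him₂
  rw [show w₂ - w₁ = d by simp [hw₂def]] at hΓ
  set J : ℂ := ∫ τ in (0 : ℝ)..1, digamma (w₁ + τ * d) * d with hJ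
  have hdnorm : ‖d‖ = (t₂ - t₁) / 2 := by
    rw [hd, norm_mul, Complex.norm_I, mul_one, Complex.norm_real, Real.norm_eq_abs,
      abs_of_nonneg (by linarith)]
  -- the digamma integral
  have hJb : ‖J‖ ≤ 7 * ‖d‖ := by
    have h := intervalIntegral.norm_integral_le_of_norm_le_const (a := (0 : ℝ)) (b := 1)
      (C := 7 * ‖d‖) (f := fun τ : ℝ ↦ digamma (w₁ + τ * d) * d) ?_
    · rw [sub_zero, abs_one, mul_one] at h
      exact h
    intro τ hτ
    rw [Set.uIoc_of_le zero_le_one] at hτ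
    rw [norm_mul]
    refine mul_le_mul_of_nonneg_right ?_ (norm_nonneg _)
    have hre : (w₁ + τ * d).re = 3 / 4 := by simp [hw₁def, hd]
    have him : (w₁ + τ * d).im = t₁ / 2 + τ * ((t₂ - t₁) / 2) := by simp [hw₁def, hd]
    apply norm_digamma_le_seven
    · rw [hre]; norm_num
    · rw [him]; nlinarith [hτ.1, hτ.2]
    · refine (Complex.norm_le_abs_re_add_abs_im _).trans ?_
      rw [hre, him, abs_of_pos (by norm_num), abs_of_nonneg (by nlinarith [hτ.1, hτ.2])]
      nlinarith [hτ.1, hτ.2]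
  -- the exponent
  have h4 : (4 : ℂ) ≠ 0 := by norm_num
  have hπ : (π : ℂ) ≠ 0 := ofReal_ne_zero.mpr Real.pi_ne_zero
  refine ⟨Complex.log 4 * d + Complex.log π * (-d) + J, ?_, ?_⟩
  · -- norm bound
    have hl4 : ‖Complex.log (4 : ℂ)‖ ≤ 139 / 100 := by
      rw [show (4 : ℂ) = ((4 : ℝ) : ℂ) by norm_num, ← Complex.ofReal_log (by norm_num),
        Complex.norm_real, Real.norm_eq_abs, abs_of_nonneg (Real.log_nonneg (by norm_num)),
        show (4 : ℝ) = 2 ^ 2 by norm_num, Real.log_pow]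
      have := Real.log_two_lt_d9
      push_cast
      linarith
    have hlπ : ‖Complex.log (π : ℂ)‖ ≤ 139 / 100 := by
      rw [← Complex.ofReal_log Real.pi_pos.le, Complex.norm_real, Real.norm_eq_abs,
        abs_of_nonneg (Real.log_nonneg (by linarith [Real.pi_gt_three]))]
      have h1 : Real.log π < Real.log 4 := Real.log_lt_log Real.pi_pos Real.pi_lt_four
      have h2 : Real.log 4 = 2 * Real.log 2 := by
        rw [show (4 : ℝ) = 2 ^ 2 by norm_num, Real.log_pow]; push_cast; ring
      have := Real.log_two_lt_d9
      linarith
    calc ‖Complex.log 4 * d + Complex.log π * (-d) + J‖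
        ≤ ‖Complex.log 4 * d‖ + ‖Complex.log π * (-d)‖ + ‖J‖ := norm_add₃_le
      _ ≤ 139 / 100 * ‖d‖ + 139 / 100 * ‖d‖ + 7 * ‖d‖ := by
          have e1 : ‖Complex.log 4 * d‖ ≤ 139 / 100 * ‖d‖ := by
            rw [norm_mul (Complex.log 4) d]; gcongr
          have e2 : ‖Complex.log π * (-d)‖ ≤ 139 / 100 * ‖d‖ := by
            rw [norm_mul (Complex.log π) (-d), norm_neg]; gcongr
          linarith
      _ ≤ 5 * (t₂ - t₁) := by rw [hdnorm]; linarith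
  · -- the identity
    unfold xiFactorChi4
    rw [Gammaℝ_def, Gammaℝ_def, hw₁, hw₂,
      show -(1 / 2 + (t₂ : ℂ) * I + 1) / 2 = -w₂ by rw [← hw₂]; ring,
      show -(1 / 2 + (t₁ : ℂ) * I + 1) / 2 = -w₁ by rw [← hw₁]; ring, hΓ, hw₂def,
      cpow_add _ _ h4, show -(w₁ + d) = -w₁ + -d by ring, cpow_add _ _ hπ,
      cpow_def_of_ne_zero h4 d, cpow_def_of_ne_zero hπ (-d), Complex.exp_add, Complex.exp_add]
    ring

/-- **A zero of `L(·, χ₄)` ON the critical line from two values.** For `2 ≤ t₁ ≤ t₂ ≤ 68`: if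
`Re(L(½+it₁, χ₄) · conj L(½+it₂, χ₄) · e^{iy}) < 0` for every `|y| ≤ 5(t₂ − t₁)`, then
`L(½+iγ, χ₄) = 0` for some `γ ∈ [t₁, t₂]` — `ξ(½+it, χ₄)` is real and continuous, and
`ξ(½+it₁)·ξ(½+it₂) = |A₁|² e^{Re E} · Re(L₁ conj L₂ e^{−i Im E}) < 0` (`xiFactorChi4_eq_mul_exp`),
so it vanishes in between. [cite: Brent1979, §3] -/
theorem exists_zero_of_lvalues (hχ : χ.IsPrimitive) {t₁ t₂ : ℝ} (h2 : 2 ≤ t₁) (h12 : t₁ ≤ t₂)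
    (h68 : t₂ ≤ 68)
    (hV : ∀ y : ℝ, |y| ≤ 5 * (t₂ - t₁) →
      (χ.LFunction (1 / 2 + t₁ * I) * conj (χ.LFunction (1 / 2 + t₂ * I)) *
        Complex.exp (y * I)).re < 0) :
    ∃ γ ∈ Set.Icc t₁ t₂, χ.LFunction (1 / 2 + γ * I) = 0 := by
  have h1 := ne_one_of_isPrimitive_four hχ
  -- the real function `f(t) = ξ(½+it, χ)`
  set f : ℝ → ℝ := fun t ↦ (dirichletXi χ (1 / 2 + t * I)).re with hf
  have hfeq : ∀ t : ℝ, dirichletXi χ (1 / 2 + t * I) = (f t : ℂ) := fun t ↦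
    Complex.ext (by simp [hf]) (by
      rw [Complex.ofReal_im]; exact dirichletXi_criticalLine_im_eq_zero hχ t)
  have hcont : Continuous f := by
    have hl : Continuous fun t : ℝ ↦ (1 / 2 : ℂ) + t * I := by fun_prop
    exact Complex.continuous_re.comp ((differentiable_dirichletXi h1).continuous.comp hl)
  -- the product of the two values
  obtain ⟨E, hE, hA⟩ := xiFactorChi4_eq_mul_exp h2 h12 h68
  have hre₁ : -1 < (1 / 2 + (t₁ : ℂ) * I).re := by simp; norm_num
  have hre₂ : -1 < (1 / 2 + (t₂ : ℂ) * I).re := by simp; norm_num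
  set A₁ : ℂ := xiFactorChi4 (1 / 2 + t₁ * I) with hA₁
  set L₁ : ℂ := χ.LFunction (1 / 2 + t₁ * I) with hL₁
  set L₂ : ℂ := χ.LFunction (1 / 2 + t₂ * I) with hL₂
  have hA₁0 : A₁ ≠ 0 := xiFactorChi4_ne_zero hre₁
  have hprod : (f t₁ : ℂ) * (f t₂ : ℂ) =
      ((Complex.normSq A₁ * Real.exp E.re : ℝ) : ℂ) *
        (L₁ * conj L₂ * Complex.exp (((-E.im : ℝ) : ℂ) * I)) := by
    have e2 : (f t₂ : ℂ) = conj (dirichletXi χ (1 / 2 + t₂ * I)) := by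
      rw [hfeq, Complex.conj_ofReal]
    rw [← hfeq t₁, e2, dirichletXi_eq_xiFactorChi4_mul hχ hre₁,
      dirichletXi_eq_xiFactorChi4_mul hχ hre₂, hA, map_mul, map_mul, ← Complex.exp_conj]
    have hc : conj E = ((E.re : ℝ) : ℂ) + ((-E.im : ℝ) : ℂ) * I := by
      apply Complex.ext <;> simp
    rw [hc, Complex.exp_add]
    push_cast
    rw [Complex.normSq_eq_conj_mul_self]
    ring
  have hy : |(-E.im)| ≤ 5 * (t₂ - t₁) := by
    rw [abs_neg]; exact (Complex.abs_im_le_norm E).trans hE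
  have hneg : f t₁ * f t₂ < 0 := by
    have h := hV (-E.im) hy
    have hpos : 0 < Complex.normSq A₁ * Real.exp E.re :=
      mul_pos (Complex.normSq_pos.2 hA₁0) (Real.exp_pos _)
    have : ((f t₁ : ℂ) * (f t₂ : ℂ)).re = f t₁ * f t₂ := by simp
    rw [← this, hprod, Complex.re_ofReal_mul]
    push_cast at h ⊢
    exact mul_neg_of_pos_of_neg hpos h
  -- intermediate value theorem
  have hIVT : ∃ γ ∈ Set.Icc t₁ t₂, f γ = 0 := by
    rcases mul_neg_iff.1 hneg with ⟨hp, hn⟩ | ⟨hn, hp⟩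
    · have := intermediate_value_Icc' h12 hcont.continuousOn
      exact this ⟨hn.le, hp.le⟩
    · have := intermediate_value_Icc h12 hcont.continuousOn
      exact this ⟨hn.le, hp.le⟩
  obtain ⟨γ, hγ, hfγ⟩ := hIVT
  refine ⟨γ, hγ, ?_⟩
  have hreγ : -1 < (1 / 2 + (γ : ℂ) * I).re := by simp; norm_num
  have hξ : dirichletXi χ (1 / 2 + γ * I) = 0 := by rw [hfeq, hfγ]; simp
  rw [dirichletXi_eq_xiFactorChi4_mul hχ hreγ] at hξ
  exact (mul_eq_zero.1 hξ).resolve_left (xiFactorChi4_ne_zero hreγ)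

end SignTest

/-! ## 3. `L′(ρ)` from two values: Cauchy's estimate twice -/

/-- **The derivative from a difference quotient.** For an entire `f` with `‖f v‖ ≤ M` on the box
`|Re v − ½| ≤ ¼`, `t₁ − ¼ ≤ Im v ≤ t₂ + ¼`, and `γ ∈ [t₁, t₂]`:
`‖f′(½+iγ) − (f(½+it₂) − f(½+it₁))/((t₂−t₁)i)‖ ≤ (t₂ − t₁)·64M` (Cauchy's estimate with radii
`1/8` twice gives `‖f″‖ ≤ 64M` on the segment; then the fundamental theorem of calculus). [folklore] -/
private theorem norm_deriv_sub_slope_le_of_bound {f : ℂ → ℂ} (hf : Differentiable ℂ f) {t₁ t₂ M : ℝ}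
    (h12 : t₁ < t₂)
    (hM : ∀ v : ℂ, |v.re - 1 / 2| ≤ 1 / 4 → t₁ - 1 / 4 ≤ v.im → v.im ≤ t₂ + 1 / 4 → ‖f v‖ ≤ M)
    {γ : ℝ} (hγ : γ ∈ Set.Icc t₁ t₂) :
    ‖deriv f (1 / 2 + γ * I) - (f (1 / 2 + t₂ * I) - f (1 / 2 + t₁ * I)) / ((t₂ - t₁ : ℝ) * I)‖ ≤
      (t₂ - t₁) * (64 * M) := by
  have hf' : Differentiable ℂ (deriv f) := fun z ↦
    ((hf.differentiableOn (s := Set.univ)).analyticOnNhd isOpen_univ).deriv.differentiableOn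
      |>.differentiableAt (Filter.univ_mem)
  -- second derivative bound on the segment
  have hM0 : 0 ≤ M := le_trans (norm_nonneg _) (hM (1 / 2 + t₁ * I) (by simp) (by simp) (by simp; linarith))
  have h2 : ∀ y ∈ Set.Icc t₁ t₂, ‖deriv (deriv f) (1 / 2 + y * I)‖ ≤ 64 * M := by
    intro y hy
    set u : ℂ := 1 / 2 + y * I with hu
    -- first derivative on the closed ball of radius 1/8
    have h1 : ∀ w : ℂ, dist w u ≤ 1 / 8 → ‖deriv f w‖ ≤ 8 * M := by
      intro w hw
      have hdc : DiffContOnCl ℂ f (ball w (1 / 8)) := hf.diffContOnCl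
      have hC : ∀ v ∈ sphere w (1 / 8), ‖f v‖ ≤ M := by
        intro v hv
        have hvu : dist v u ≤ 1 / 4 := by
          calc dist v u ≤ dist v w + dist w u := dist_triangle _ _ _
            _ ≤ 1 / 8 + 1 / 8 := add_le_add (mem_sphere.1 hv).le hw
            _ = 1 / 4 := by norm_num
        rw [Complex.dist_eq] at hvu
        have hre : |v.re - 1 / 2| ≤ ‖v - u‖ := by
          have := Complex.abs_re_le_norm (v - u); simpa [hu] using this
        have him : |v.im - y| ≤ ‖v - u‖ := by
          have := Complex.abs_im_le_norm (v - u); simpa [hu] using this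
        have hre' := abs_le.1 (hre.trans hvu)
        have him' := abs_le.1 (him.trans hvu)
        exact hM v (by rw [abs_le]; constructor <;> linarith) (by linarith [hy.1])
          (by linarith [hy.2])
      have := Complex.norm_deriv_le_of_forall_mem_sphere_norm_le (by norm_num) hdc hC
      calc ‖deriv f w‖ ≤ M / (1 / 8) := this
        _ = 8 * M := by ring
    have hdc : DiffContOnCl ℂ (deriv f) (ball u (1 / 8)) := hf'.diffContOnCl
    have := Complex.norm_deriv_le_of_forall_mem_sphere_norm_le (by norm_num) hdc
      (fun v hv ↦ h1 v (mem_sphere.1 hv).le)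
    calc ‖deriv (deriv f) u‖ ≤ 8 * M / (1 / 8) := this
      _ = 64 * M := by ring
  -- FTC along the segment
  set φ : ℝ → ℂ := fun t ↦ f (1 / 2 + t * I) with hφ
  set ψ : ℝ → ℂ := fun t ↦ deriv f (1 / 2 + t * I) with hψ
  have hl : ∀ t : ℝ, HasDerivAt (fun t : ℝ ↦ (1 / 2 : ℂ) + t * I) I t := fun t ↦ by
    have := ((hasDerivAt_id (t : ℂ)).mul_const I).const_add (1 / 2 : ℂ)
    simpa using this.comp_ofReal
  have hderφ : ∀ t : ℝ, HasDerivAt φ (I * ψ t) t := by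
    intro t
    have h := ((hf _).hasDerivAt).comp t (hl t)
    rw [mul_comm] at h
    exact h
  have hcontψ : Continuous ψ := hf'.continuous.comp (by fun_prop)
  have hFTC : φ t₂ - φ t₁ = ∫ t in t₁..t₂, I * ψ t := by
    rw [intervalIntegral.integral_eq_sub_of_hasDerivAt (fun t _ ↦ hderφ t)]
    exact (continuous_const.mul hcontψ).intervalIntegrable _ _
  -- `ψ` is Lipschitz on the segment
  have hlip : ∀ t ∈ Set.Icc t₁ t₂, ‖ψ t - ψ γ‖ ≤ |t - γ| * (64 * M) := by
    intro t ht
    have hseg : ∀ u ∈ segment ℝ ((1 / 2 : ℂ) + γ * I) (1 / 2 + t * I),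
        ‖deriv (deriv f) u‖ ≤ 64 * M := by
      intro u hu
      rw [segment_eq_image_lineMap] at hu
      obtain ⟨θ, hθ, rfl⟩ := hu
      simp only [AffineMap.lineMap_apply_module]
      set u : ℂ := (1 - θ) • ((1 / 2 : ℂ) + γ * I) + θ • (1 / 2 + t * I) with hu
      have hure : u.re = 1 / 2 := by simp [hu]; ring
      have huim : u.im = (1 - θ) * γ + θ * t := by simp [hu]
      have e : u = (1 / 2 : ℂ) + (((1 - θ) * γ + θ * t : ℝ)) * I :=
        Complex.ext (by simp [hure]) (by simp [huim])
      rw [e]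
      apply h2
      constructor <;> nlinarith [hθ.1, hθ.2, hγ.1, hγ.2, ht.1, ht.2]
    have := (convex_segment ((1 / 2 : ℂ) + γ * I) (1 / 2 + t * I)).norm_image_sub_le_of_norm_deriv_le
      (f := deriv f) (fun u _ ↦ hf' u) hseg (left_mem_segment _ _ _) (right_mem_segment _ _ _)
    change ‖deriv f (1 / 2 + t * I) - deriv f (1 / 2 + γ * I)‖ ≤ _
    refine this.trans (le_of_eq ?_)
    rw [show (1 / 2 : ℂ) + t * I - (1 / 2 + γ * I) = ((t - γ : ℝ)) * I by push_cast; ring,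
      norm_mul, Complex.norm_I, mul_one, Complex.norm_real, Real.norm_eq_abs, mul_comm]
  -- conclude
  have hpos : 0 < t₂ - t₁ := by linarith
  have hkey : deriv f (1 / 2 + γ * I) - (φ t₂ - φ t₁) / ((t₂ - t₁ : ℝ) * I) =
      -((∫ t in t₁..t₂, (ψ t - ψ γ)) / (t₂ - t₁ : ℝ)) := by
    rw [hFTC, intervalIntegral.integral_const_mul, intervalIntegral.integral_sub
      (hcontψ.intervalIntegrable _ _) intervalIntegrable_const,
      intervalIntegral.integral_const, Complex.real_smul]
    have hI : ((t₂ - t₁ : ℝ) : ℂ) * I ≠ 0 := by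
      apply mul_ne_zero _ I_ne_zero; exact_mod_cast hpos.ne'
    have hr : ((t₂ - t₁ : ℝ) : ℂ) ≠ 0 := by exact_mod_cast hpos.ne'
    simp only [hψ]
    field_simp
    push_cast
    ring
  rw [hkey, norm_neg, norm_div, Complex.norm_real, Real.norm_eq_abs, abs_of_pos hpos,
    div_le_iff₀ hpos]
  have hbound : ‖∫ t in t₁..t₂, (ψ t - ψ γ)‖ ≤ (t₂ - t₁) * (64 * M) * |t₂ - t₁| := by
    refine intervalIntegral.norm_integral_le_of_norm_le_const fun t ht ↦ ?_
    rw [Set.uIoc_of_le h12.le] at ht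
    have ht' : t ∈ Set.Icc t₁ t₂ := ⟨ht.1.le, ht.2⟩
    refine (hlip t ht').trans ?_
    have : |t - γ| ≤ t₂ - t₁ := by
      rw [abs_le]; constructor <;> linarith [hγ.1, hγ.2, ht.1, ht.2]
    have h4 : 0 ≤ 64 * M := by positivity
    nlinarith
  rw [abs_of_pos hpos] at hbound
  linarith

/-! ## 4. The certificate -/

/-- **Rotations of a box in the left half-plane**: if `v ∈ V`, `hi(Re V) < 0` and
`K·hi(Re V) + 2·absHi(Im V) < 0`, then `Re(v·e^{iy}) < 0` for all `|y| ≤ 1/K`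
(`cos y ≥ ½`, `|sin y| ≤ |y|`). [folklore] -/
private theorem re_mul_exp_neg_of_box {S : ℕ} (hS : 0 < S) {v : ℂ} {V : MC} (hv : MC.mem S v V) {K : ℕ}
    (hK : 1 ≤ K) (h1 : V.re.hi < 0) (h2 : V.re.hi * K + 2 * V.im.absHi < 0) {y : ℝ}
    (hy : |y| ≤ 1 / K) : (v * Complex.exp (y * I)).re < 0 := by
  have hSr : (0 : ℝ) < S := by exact_mod_cast hS
  have hKr : (1 : ℝ) ≤ K := by exact_mod_cast hK
  have hK0 : (0 : ℝ) < K := by linarith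
  have hvre : v.re * S ≤ V.re.hi := hv.1.2
  have hvim : |v.im| * S ≤ V.im.absHi := MI.abs_le_absHi hv.2
  have h1r : (V.re.hi : ℝ) < 0 := by exact_mod_cast h1
  have h2r : (V.re.hi : ℝ) * K + 2 * V.im.absHi < 0 := by exact_mod_cast h2
  have hy1 : |y| ≤ 1 := hy.trans (by rw [div_le_one hK0]; exact hKr)
  have hcos : 1 / 2 ≤ Real.cos y := by
    have hc := Real.one_sub_sq_div_two_le_cos (x := y)
    have hy2 : y ^ 2 ≤ 1 := by
      have := abs_le.1 hy1
      nlinarith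
    linarith
  have hsin : |Real.sin y| ≤ 1 / K := Real.abs_sin_le_abs.trans hy
  have hvneg : v.re < 0 := by
    by_contra hge
    push Not at hge
    have := mul_nonneg hge hSr.le
    linarith
  have hre : (v * Complex.exp (y * I)).re = v.re * Real.cos y - v.im * Real.sin y := by
    rw [Complex.mul_re, Complex.exp_ofReal_mul_I_re, Complex.exp_ofReal_mul_I_im]
  have a1 : v.re * Real.cos y * S ≤ V.re.hi / 2 := by
    have : v.re * Real.cos y ≤ v.re * (1 / 2) := mul_le_mul_of_nonpos_left hcos hvneg.le
    nlinarith
  have a2 : -(v.im * Real.sin y) * S ≤ V.im.absHi / K := by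
    have h3 : -(v.im * Real.sin y) ≤ |v.im| * (1 / K) :=
      calc -(v.im * Real.sin y) ≤ |v.im * Real.sin y| := neg_le_abs _
        _ = |v.im| * |Real.sin y| := abs_mul _ _
        _ ≤ |v.im| * (1 / K) := by gcongr
    have h4 : -(v.im * Real.sin y) * S ≤ |v.im| * (1 / K) * S :=
      mul_le_mul_of_nonneg_right h3 hSr.le
    have h5 : |v.im| * (1 / K) * S = (|v.im| * S) / K := by ring
    rw [h5] at h4
    exact h4.trans (div_le_div_of_nonneg_right hvim hK0.le)
  rw [hre]
  by_contra hge
  push Not at hge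
  have h4 : 0 ≤ (v.re * Real.cos y - v.im * Real.sin y) * S := mul_nonneg hge hSr.le
  have h5 : (V.re.hi : ℝ) / 2 + V.im.absHi / K < 0 := by
    have : (V.re.hi : ℝ) / 2 + V.im.absHi / K = ((V.re.hi : ℝ) * K + 2 * V.im.absHi) / (2 * K) := by
      field_simp
    rw [this]
    exact div_neg_of_neg_of_pos h2r (by positivity)
  nlinarith

namespace ConreyLi2000Chi4Cert

/-- Scale `2^80` of the interval arithmetic. [folklore] -/
def S : ℕ := 2 ^ 80

/-- `t₁ = T1 / 2^48 = 67.63692086342965…` (`γ − 2⁻³³`, rounded to `2⁻⁴⁸`). [folklore] -/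
def T1 : ℤ := 19038100724814345

/-- `t₂ = T2 / 2^48 = t₁ + 2⁻³²`. [folklore] -/
def T2 : ℤ := T1 + 2 ^ 16

/-- `[t₁, t₁]`. [folklore] -/
def t1I : MI := MI.ofFrac S T1 (2 ^ 48)

/-- `[t₂, t₂]`. [folklore] -/
def t2I : MI := MI.ofFrac S T2 (2 ^ 48)

/-- `[t₁, t₂] ∋ γ`. [folklore] -/
def gammaI : MI := t1I.span t2I

/-- The box `{½ + i t₁}`. [folklore] -/
def box1 : MC := ⟨MI.ofFrac S 1 2, t1I⟩

/-- The box `{½ + i t₂}`. [folklore] -/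
def box2 : MC := ⟨MI.ofFrac S 1 2, t2I⟩

/-- The box `{3/2} × [t₁, t₂]`. [folklore] -/
def box3 : MC := ⟨MI.ofFrac S 3 2, gammaI⟩

/-- The box `[¼, ¾] × [t₁ − ¼, t₂ + ¼]` on which `L(·, χ₄)` is bounded for Cauchy's estimate.
[folklore] -/
def boxQ : MC :=
  ⟨(MI.ofFrac S 1 4).span (MI.ofFrac S 3 4), (t1I.sub (MI.ofFrac S 1 4)).span (t2I.add (MI.ofFrac S 1 4))⟩

/-- The box `{½} × [t₁, t₂] ∋ ρ`. [folklore] -/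
def rhoBox : MC := ⟨MI.ofFrac S 1 2, gammaI⟩

/-- The box `{1} × [−1, −4095/4096] ∋ 1 − iτ`, `τ ∈ [1 − 2⁻¹², 1]`. [folklore] -/
def tauBox : MC := ⟨MI.ofInt S 1, (MI.ofInt S (-1)).span (MI.ofFrac S (-4095) 4096)⟩

/-- Scaled radius for the slope: `(t₂ − t₁) · 64 M · S = absHi(Z_Q)/2²⁶` rounded up, where
`M = absHi(Z_Q)/S` bounds `‖L‖` on `boxQ`. [folklore] -/
def slopeRadius (ZQ : MC) : ℤ := Literature.Analysis.ValidatedNumerics.Numerics.cdiv ZQ.absHi (2 ^ 26)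

/-- The box `D ∋ L'(½ + iγ, χ₄)` for every `γ ∈ [t₁, t₂]`: the slope
`(L₂ − L₁)/((t₂ − t₁) i) = (L₂ − L₁) · (−i) · 2³²` widened by `slopeRadius`. [folklore] -/
def slopeBox (Z1 Z2 ZQ : MC) : MC :=
  (((Z2.sub Z1).mulNegI).mulInt (2 ^ 32)).widen (slopeRadius ZQ)

/-- The final box `W ∋ conj L'(ρ) · L(3/2 + iγ) · ρ · (1 − iτ)`. [folklore] -/
def wBox (Z1 Z2 Z3 ZQ : MC) : MC :=
  MC.mul S (MC.mul S (MC.mul S (slopeBox Z1 Z2 ZQ).conj Z3) rhoBox) tauBox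

/-- Evaluation of `L(·, χ₄)` on a box with the fixed parameters of this certificate: scale `2^80`,
Euler–Maclaurin truncation point `N = 64` with `ν = 14` corrections for `ζ(s, ¼)`, `ζ(s, ¾)`;
`π`, `log 4` and `log(n + a)` at scale `2^90` (`95` series terms, Machin with `22` terms), `16`
Taylor terms and `8` halvings for `exp`/`expI` (`none` on any failure). [folklore] -/
def evalL (B : MC) : Option MC := lchi4Eval S 64 14 10 95 22 16 8 16 8 B

/-- The value of `evalL box1` (`∋ L(½+it₁, χ₄) ≈ (−2.39 − 1.09i)·10⁻¹⁰`), recorded as a literal and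
re-verified by the kernel (`evalL_box1`). [folklore] -/
def Z1 : MC := ⟨⟨-289415529543373, -289415529066516⟩, ⟨-132334487876975, -132334487401556⟩⟩

/-- The value of `evalL box2` (`∋ L(½+it₂, χ₄)`). [folklore] -/
def Z2 : MC := ⟨⟨289424176993260, 289424177470085⟩, ⟨132338441487292, 132338441962660⟩⟩

/-- The value of `evalL box3` (`∋ L(3/2+iγ, χ₄) ≈ 0.7666 − 0.2235i`). [folklore] -/
def Z3 : MC :=
  ⟨⟨926816295669077684841839, 926816298117584355368935⟩,
    ⟨-270175568370062470825872, -270175565921556287620146⟩⟩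

/-- The value of `evalL boxQ` (`|L| ≤ 331` on `[¼, ¾] × [t₁ − ¼, t₂ + ¼]`). [folklore] -/
def ZQ : MC :=
  ⟨⟨-193098413017223017561501121, 201054060965485330404792903⟩,
    ⟨-198431079583235601448856906, 195832338855789225912281159⟩⟩

/-- **The certificate check** on the four recorded boxes: the twisted sign test
`hi Re V < 0 ∧ 2²⁹ hi Re V + 2 absHi Im V < 0` (`V = Z1 · conj Z2 ∋ L₁ conj L₂`) and `hi Re W < 0`.
[folklore] -/
def check : Bool :=
  decide ((MC.mul S Z1 Z2.conj).re.hi < 0) &&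
    decide ((MC.mul S Z1 Z2.conj).re.hi * (2 ^ 29 : ℕ) + 2 * (MC.mul S Z1 Z2.conj).im.absHi < 0) &&
    decide ((wBox Z1 Z2 Z3 ZQ).re.hi < 0)

/-! ### Soundness of the certificate -/

/-- `t₁ = T1 / 2⁴⁸`. [folklore] -/
noncomputable def t₁ : ℝ := (T1 : ℝ) / 2 ^ 48

/-- `t₂ = T2 / 2⁴⁸`. [folklore] -/
noncomputable def t₂ : ℝ := (T2 : ℝ) / 2 ^ 48

/-- `t₂ − t₁ = 2⁻³²`. [folklore] -/
private lemma t₂_sub_t₁ : t₂ - t₁ = ((2 : ℝ) ^ 32)⁻¹ := by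
  unfold t₁ t₂ T2
  push_cast
  ring

/-- `67.63 < t₁`. [folklore] -/
private lemma lt_t₁ : (67.63 : ℝ) < t₁ := by unfold t₁ T1; norm_num

/-- `t₂ < 67.64`. [folklore] -/
private lemma t₂_lt : t₂ < (67.64 : ℝ) := by unfold t₂ T2 T1; norm_num

/-- `t₁ < t₂`. [folklore] -/
private lemma t₁_lt_t₂ : t₁ < t₂ := by
  have h := t₂_sub_t₁
  have : (0 : ℝ) < ((2 : ℝ) ^ 32)⁻¹ := by positivity
  linarith

/-- `0 < S`. [folklore] -/
private lemma S_pos : 0 < S := by unfold S; positivity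

/-- `t₁ ∈ t1I`. [folklore] -/
private lemma mem_t1I : MI.mem S t₁ t1I := by
  have := MI.mem_ofFrac S T1 (q := 2 ^ 48) (by positivity)
  unfold t₁ t1I
  convert this using 2
  push_cast
  ring

/-- `t₂ ∈ t2I`. [folklore] -/
private lemma mem_t2I : MI.mem S t₂ t2I := by
  have := MI.mem_ofFrac S T2 (q := 2 ^ 48) (by positivity)
  unfold t₂ t2I
  convert this using 2
  push_cast
  ring

/-- `γ ∈ gammaI` for `t₁ ≤ γ ≤ t₂`. [folklore] -/
private lemma mem_gammaI {γ : ℝ} (h1 : t₁ ≤ γ) (h2 : γ ≤ t₂) : MI.mem S γ gammaI :=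
  MI.mem_span mem_t1I mem_t2I h1 h2

/-- `x + it ∈ ⟨[p/q], J⟩` from `t ∈ J` (`x = p/q`). [folklore] -/
private lemma mem_lineBox {t x : ℝ} {p : ℤ} {q : ℕ} (hq : 0 < q) (hx : x = (p : ℝ) / q) {J : MI}
    (ht : MI.mem S t J) : MC.mem S ((x : ℂ) + t * I) ⟨MI.ofFrac S p q, J⟩ := by
  refine ⟨?_, by simpa using ht⟩
  have := MI.mem_ofFrac S p (q := q) hq
  rw [← hx] at this
  simpa using this

/-- `v ∈ boxQ` for `|Re v − ½| ≤ ¼`, `t₁ − ¼ ≤ Im v ≤ t₂ + ¼`. [folklore] -/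
private lemma mem_boxQ {v : ℂ} (hre : |v.re - 1 / 2| ≤ 1 / 4) (him1 : t₁ - 1 / 4 ≤ v.im)
    (him2 : v.im ≤ t₂ + 1 / 4) : MC.mem S v boxQ := by
  obtain ⟨ha, hb⟩ := abs_le.1 hre
  refine ⟨?_, ?_⟩
  · have h := MI.mem_span (x := v.re) (MI.mem_ofFrac S 1 (q := 4) (by norm_num))
      (MI.mem_ofFrac S 3 (q := 4) (by norm_num)) (by push_cast; linarith) (by push_cast; linarith)
    simpa [boxQ] using h
  · have h := MI.mem_span (x := v.im) (MI.mem_sub mem_t1I (MI.mem_ofFrac S 1 (q := 4) (by norm_num)))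
      (MI.mem_add mem_t2I (MI.mem_ofFrac S 1 (q := 4) (by norm_num))) (by push_cast; linarith)
      (by push_cast; linarith)
    simpa [boxQ] using h

/-- `1 − iτ ∈ tauBox` for `τ ∈ [1 − 2⁻¹², 1]`. [folklore] -/
private lemma mem_tauBox {τ : ℝ} (hτ : τ ∈ Set.Icc (1 - (1 / 4096 : ℝ)) 1) :
    MC.mem S (1 - (τ : ℂ) * I) tauBox := by
  refine ⟨by simpa [tauBox] using MI.mem_ofInt S 1, ?_⟩
  have h := MI.mem_span (x := -τ) (MI.mem_ofInt S (-1)) (MI.mem_ofFrac S (-4095) (q := 4096) (by norm_num))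
    (by push_cast; linarith [hτ.2]) (by push_cast; linarith [hτ.1])
  simpa [tauBox] using h

/-- The slope as a product: `a / (2⁻³² i) = a · (−i) · 2³²`. [folklore] -/
private lemma div_eq_mul_negI (a : ℂ) :
    a / (((((2 : ℝ) ^ 32)⁻¹ : ℝ) : ℂ) * I) = a * -I * ((2 ^ 32 : ℤ) : ℂ) := by
  have hI : (I : ℂ) ≠ 0 := I_ne_zero
  push_cast
  field_simp
  ring_nf
  simp [I_sq]

/-- **Soundness of the evaluator with the fixed parameters**: `evalL B = some Z`, `s ∈ B`, `s ≠ 1`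
give `L(s, χ) ∈ Z` for the primitive character `χ` mod `4`. [folklore] -/
private theorem mem_evalL {χ : DirichletCharacter ℂ 4} (hχ : χ.IsPrimitive) {s : ℂ} {B Z : MC}
    (hs : MC.mem S s B) (hs1 : s ≠ 1) (h : evalL B = some Z) : MC.mem S (χ.LFunction s) Z :=
  mem_lchi4Eval hχ hs hs1 h

/-- **Soundness of the certificate.** If the kernel's four evaluations are the recorded boxes and
`check = true`, then for the primitive character `χ` mod `4` there is a zero `½ + iγ` of `L(·, χ)`
with `γ ∈ [t₁, t₂]`, and for every such zero and every `τ ∈ [1 − 2⁻¹², 1]`,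
`Re{conj L'(½+iγ, χ) · L(3/2+iγ, χ) · ((½+iγ)(1 − iτ))} < 0`. [folklore] -/
private theorem sound (hZ1 : evalL box1 = some Z1) (hZ2 : evalL box2 = some Z2) (hZ3 : evalL box3 = some Z3)
    (hZQ : evalL boxQ = some ZQ) (h : check = true) {χ : DirichletCharacter ℂ 4}
    (hχ : χ.IsPrimitive) :
    ∃ γ ∈ Set.Icc t₁ t₂, χ.LFunction (1 / 2 + γ * I) = 0 ∧
      ∀ τ ∈ Set.Icc (1 - (1 / 4096 : ℝ)) 1,
        (conj (deriv χ.LFunction (1 / 2 + γ * I)) * χ.LFunction (3 / 2 + γ * I) *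
          ((1 / 2 + γ * I) * (1 - (τ : ℂ) * I))).re < 0 := by
  have h1 := ne_one_of_isPrimitive_four hχ
  unfold check at h
  simp only [Bool.and_eq_true, decide_eq_true_eq] at h
  obtain ⟨⟨hV1, hV2⟩, hW⟩ := h
  -- evaluation lemma
  have hL : ∀ {s : ℂ} {B Z : MC}, MC.mem S s B → s ≠ 1 → evalL B = some Z →
      MC.mem S (χ.LFunction s) Z := fun hs hs1 hZ ↦ mem_evalL hχ hs hs1 hZ
  have hne1 : ∀ s : ℂ, t₁ - 1 / 4 ≤ s.im → s ≠ 1 := fun s hs h ↦ by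
    rw [h] at hs; simp at hs; linarith [lt_t₁]
  have hhalf : ((1 / 2 : ℝ) : ℂ) = 1 / 2 := by push_cast; ring
  -- the two values on the line
  have hz1 : MC.mem S (χ.LFunction (1 / 2 + t₁ * I)) Z1 := by
    have hb := mem_lineBox (t := t₁) (x := 1 / 2) (p := 1) (q := 2) two_pos (by norm_num) mem_t1I
    rw [hhalf] at hb
    exact hL hb (hne1 _ (by simp)) hZ1
  have hz2 : MC.mem S (χ.LFunction (1 / 2 + t₂ * I)) Z2 := by
    have hb := mem_lineBox (t := t₂) (x := 1 / 2) (p := 1) (q := 2) two_pos (by norm_num) mem_t2I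
    rw [hhalf] at hb
    exact hL hb (hne1 _ (by simp; linarith [t₁_lt_t₂])) hZ2
  -- twisted sign test: a zero on the line in `[t₁, t₂]`
  have hVmem := MC.mem_mul S_pos hz1 (MC.mem_conj hz2)
  have hsign : ∀ y : ℝ, |y| ≤ 5 * (t₂ - t₁) →
      (χ.LFunction (1 / 2 + t₁ * I) * conj (χ.LFunction (1 / 2 + t₂ * I)) *
        Complex.exp (y * I)).re < 0 := by
    intro y hy
    refine re_mul_exp_neg_of_box S_pos hVmem (K := 2 ^ 29) (by norm_num) hV1
      (by exact_mod_cast hV2) (hy.trans ?_)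
    rw [t₂_sub_t₁]; norm_num
  obtain ⟨γ, hγ, hzero⟩ := exists_zero_of_lvalues hχ (by linarith [lt_t₁]) t₁_lt_t₂.le
    (by linarith [t₂_lt]) hsign
  refine ⟨γ, hγ, hzero, fun τ hτ ↦ ?_⟩
  -- the bound `M` on the box
  have hM : ∀ v : ℂ, |v.re - 1 / 2| ≤ 1 / 4 → t₁ - 1 / 4 ≤ v.im → v.im ≤ t₂ + 1 / 4 →
      ‖χ.LFunction v‖ ≤ (ZQ.absHi : ℝ) / S := by
    intro v hre him1 him2
    have hv1 : v ≠ 1 := fun h ↦ by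
      have := congrArg Complex.im h; simp at this; linarith [lt_t₁]
    have hmem := hL (mem_boxQ hre him1 him2) hv1 hZQ
    have := MC.norm_le_absHi hmem
    rw [le_div_iff₀ (by exact_mod_cast S_pos)]
    exact this
  -- `L'(½ + iγ) ∈ slopeBox`
  have hD : MC.mem S (deriv χ.LFunction (1 / 2 + γ * I)) (slopeBox Z1 Z2 ZQ) := by
    have hslope := norm_deriv_sub_slope_le_of_bound (DirichletCharacter.differentiable_LFunction h1)
      t₁_lt_t₂ hM hγ
    have hmem : MC.mem S ((χ.LFunction (1 / 2 + t₂ * I) - χ.LFunction (1 / 2 + t₁ * I)) /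
        ((t₂ - t₁ : ℝ) * I)) (((Z2.sub Z1).mulNegI).mulInt (2 ^ 32)) := by
      have := MC.mem_mulInt (MC.mem_mulNegI (MC.mem_sub hz2 hz1)) (2 ^ 32)
      rwa [t₂_sub_t₁, div_eq_mul_negI]
    unfold slopeBox
    apply MC.mem_widen hmem
    have hSr : (0 : ℝ) < S := by exact_mod_cast S_pos
    calc ‖deriv χ.LFunction (1 / 2 + γ * I) -
            (χ.LFunction (1 / 2 + t₂ * I) - χ.LFunction (1 / 2 + t₁ * I)) / ((t₂ - t₁ : ℝ) * I)‖ * S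
        ≤ (t₂ - t₁) * (64 * ((ZQ.absHi : ℝ) / S)) * S :=
          mul_le_mul_of_nonneg_right hslope (by positivity)
      _ = (ZQ.absHi : ℝ) / 2 ^ 26 := by
          rw [t₂_sub_t₁]
          field_simp
          ring
      _ ≤ slopeRadius ZQ := by
          unfold slopeRadius
          have := Literature.Analysis.ValidatedNumerics.Numerics.div_le_cdiv (a := ZQ.absHi)
            (b := 2 ^ 26) (by norm_num)
          norm_num at this ⊢
          exact this
  -- `L(3/2 + iγ) ∈ Z3`
  have hγI : MI.mem S γ gammaI := mem_gammaI hγ.1 hγ.2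
  have hz3 : MC.mem S (χ.LFunction (3 / 2 + γ * I)) Z3 := by
    have hb := mem_lineBox (t := γ) (x := 3 / 2) (p := 3) (q := 2) two_pos (by norm_num) hγI
    have e : ((3 / 2 : ℝ) : ℂ) = 3 / 2 := by push_cast; ring
    rw [e] at hb
    exact hL hb (hne1 _ (by simp; linarith [hγ.1])) hZ3
  -- `ρ ∈ rhoBox`
  have hρ : MC.mem S (1 / 2 + (γ : ℂ) * I) rhoBox := by
    have hb := mem_lineBox (t := γ) (x := 1 / 2) (p := 1) (q := 2) two_pos (by norm_num) hγI
    rw [hhalf] at hb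
    exact hb
  -- the final product
  have hWmem := MC.mem_mul S_pos (MC.mem_mul S_pos (MC.mem_mul S_pos (MC.mem_conj hD) hz3) hρ)
    (mem_tauBox hτ)
  have := MI.neg_of_hi_neg hWmem.1 hW
  simpa [mul_assoc] using this

end ConreyLi2000Chi4Cert

/-- **Discharge of `ConreyLi2000_HE_chi4` from the certificate** (Conrey–Li 2000, §3.2): for the
primitive character `χ` mod `4` there is a zero `ρ = ½ + iγ`, `67.63 < γ < 67.64`, of `ξ(·, χ)`
with `Re{conj ξ'(ρ, χ) · ξ(1+ρ, χ)} < 0`. The certificate brackets `γ ∈ [t₁, t₂]` (`t₂ − t₁ = 2⁻³²`)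
by the sign of `ξ(½+it₁)ξ(½+it₂)` and bounds `Re{conj L'(ρ) L(3/2+iγ) ρ (1 − iτ)} < 0` for
`τ ∈ [1 − 2⁻¹², 1]`; the reduction `re_conj_deriv_dirichletXi_mul_eq` (reflection formula for
`Γ_ℝ`, no `Γ`-numerics) turns this into the sign of Conrey–Li's quantity (their printed value is
`−2.3103…·10⁻⁴⁵` for `ξ_CL = (√π/2)ξ`). [cite: ConreyLi2000, §3.2] -/
theorem ConreyLi2000_HE_chi4_holds_of_check
    (hZ1 : ConreyLi2000Chi4Cert.evalL ConreyLi2000Chi4Cert.box1 = some ConreyLi2000Chi4Cert.Z1)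
    (hZ2 : ConreyLi2000Chi4Cert.evalL ConreyLi2000Chi4Cert.box2 = some ConreyLi2000Chi4Cert.Z2)
    (hZ3 : ConreyLi2000Chi4Cert.evalL ConreyLi2000Chi4Cert.box3 = some ConreyLi2000Chi4Cert.Z3)
    (hZQ : ConreyLi2000Chi4Cert.evalL ConreyLi2000Chi4Cert.boxQ = some ConreyLi2000Chi4Cert.ZQ)
    (hc : ConreyLi2000Chi4Cert.check = true) :
    ConreyLi2000_HE_chi4 := by
  intro χ hχ
  obtain ⟨γ, ⟨hγ1, hγ2⟩, hz, hneg⟩ := ConreyLi2000Chi4Cert.sound hZ1 hZ2 hZ3 hZQ hc hχ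
  have h1 : (67.63 : ℝ) < γ := lt_of_lt_of_le ConreyLi2000Chi4Cert.lt_t₁ hγ1
  have h2 : γ < 67.64 := lt_of_le_of_lt hγ2 ConreyLi2000Chi4Cert.t₂_lt
  refine ⟨1 / 2 + γ * I, ?_, by simp, by simpa using h1, by simpa using h2, ?_⟩
  · have hre : -1 < (1 / 2 + (γ : ℂ) * I).re := by simp; norm_num
    rw [dirichletXi_eq_xiFactorChi4_mul hχ hre, hz, mul_zero]
  · obtain ⟨c, hc, heq⟩ := re_conj_deriv_dirichletXi_mul_eq hχ hz
    rw [heq]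
    exact mul_neg_of_pos_of_neg hc (hneg _ (tanh_mem_Icc_of_ge (by linarith)))

/-! ## 5. The kernel's verdict and the discharge

The four evaluations are checked by the kernel one declaration at a time (each about half a minute:
the two Hurwitz tables at scale `2^80` and two evaluations of `ζ(s, ¼)`, `ζ(s, ¾)`), against the
literal boxes `Z1`, `Z2`, `Z3`, `ZQ` recorded in §4; the sign checks on the literals are then instant. -/

namespace ConreyLi2000Chi4Cert

set_option maxHeartbeats 0 in
/-- The kernel's evaluation on `box1` is the recorded box `Z1` (`decide +kernel`). [folklore] -/
private theorem evalL_box1 : evalL box1 = some Z1 := by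
  decide +kernel

set_option maxHeartbeats 0 in
/-- The kernel's evaluation on `box2` is the recorded box `Z2` (`decide +kernel`). [folklore] -/
private theorem evalL_box2 : evalL box2 = some Z2 := by
  decide +kernel

set_option maxHeartbeats 0 in
/-- The kernel's evaluation on `box3` is the recorded box `Z3` (`decide +kernel`). [folklore] -/
private theorem evalL_box3 : evalL box3 = some Z3 := by
  decide +kernel

set_option maxHeartbeats 0 in
/-- The kernel's evaluation on `boxQ` is the recorded box `ZQ` (`decide +kernel`). [folklore] -/
private theorem evalL_boxQ : evalL boxQ = some ZQ := by
  decide +kernel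

/-- **The kernel accepts the certificate**: the three sign checks on the recorded boxes
(`decide +kernel`). [folklore] -/
private theorem check_holds : check = true := by
  decide +kernel

end ConreyLi2000Chi4Cert

/-- **`ConreyLi2000_HE_chi4` holds**: de Branges' `𝓗(E_{χ₄})`-positivity condition (3.7) fails for
`L(s, χ₄)`, witnessed at the zero `½ + i·67.6369208635…` (Conrey–Li 2000, §3.2), with the sign of
`Re{conj ξ′(ρ, χ₄) ξ(1+ρ, χ₄)}` now certified by the Lean kernel. [cite: ConreyLi2000, §3.2] -/
theorem ConreyLi2000_HE_chi4_holds : ConreyLi2000_HE_chi4 :=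
  ConreyLi2000_HE_chi4_holds_of_check ConreyLi2000Chi4Cert.evalL_box1
    ConreyLi2000Chi4Cert.evalL_box2 ConreyLi2000Chi4Cert.evalL_box3
    ConreyLi2000Chi4Cert.evalL_boxQ ConreyLi2000Chi4Cert.check_holds

/-- **The barrier `DeBrangesPositivityDirichlet` holds unconditionally**: both printed failures of
de Branges' positivity conditions for Dirichlet `L`-functions are now tree theorems — (3.7) for
`𝓗(E_{χ₄})` by `ConreyLi2000_HE_chi4_holds` (this file) and (3.8) for `𝓕(W_χ)`, every `χ`, by
`ConreyLi2000_FW_char_holds` (Sarnak's proof, `DeBrangesPositivityDirichletProofs.lean`).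
[cite: ConreyLi2000, §3.2 and §4] -/
theorem DeBrangesPositivityDirichlet_holds : DeBrangesPositivityDirichlet :=
  DeBrangesPositivityDirichlet_of_HE_chi4 ConreyLi2000_HE_chi4_holds

end Literature.Barriers.RiemannHypothesis
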